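import Summits.Ventures.PercRepro.C041ZonePortDefs

/-!
# The zone port problem of THEOREM R: CASE (iii) — a forced-free gate (p6, gen 24)

Setting of `C041ZonePortDefs` (mine-3, C-041.md §3 (iii) / §6 (c)).  A non-switchable gate zone has all its terminal
edges red in every admissible pattern, so by THE KEY FACT every admissible pattern is Good on the side opposite to one
of its edges: `1 ≤ weight x`, hence `0 ≤ Φ∨ P` and `0 ≤ Φ∧ P` (`phiOr_nonneg_of_forced_gate`,
`phiAnd_nonneg_of_forced_gate`).
-/

namespace PercRepro

namespace ZonePort

namespace Problem

open Finset

variable {V E : Type*}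

section Forced

variable {P : Problem V E}

/-- In an admissible pattern every edge of a non-switchable zone is red. -/
theorem red_of_forced {x : P.Term → Bool} (hx : P.Adm x) {C : Finset V} (hsw : P.sw C = false) :
    ∀ e : P.Term, P.tz e.1 = C → x e = true :=
  fun e he => hx.1 e (he ▸ hsw)

/-- **Case (iii)**: a non-switchable gate makes every admissible pattern Good on a side. -/
theorem good_of_forced_gate {x : P.Term → Bool} (hx : P.Adm x) {C : Finset V} (hC : P.IsGate C)
    (hsw : P.sw C = false) : P.Good₁ x ∨ P.Good₂ x := by
  obtain ⟨e, he⟩ := P.hk C hC.mem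
  let e' : P.Term := ⟨e, he ▸ hC.mem⟩
  have hred : ∀ f : P.Term, P.tz f.1 = P.tz e'.1 → x f = true := fun f hf =>
    red_of_forced hx hsw f (hf.trans he)
  have hC' : P.IsGate (P.tz e'.1) := by
    show P.IsGate (P.tz e)
    rw [he]
    exact hC
  cases hs : P.ts e
  · exact Or.inr (good₂_of_red_gate hC' hs (hred e' rfl) (fun f hf _ => hred f hf))
  · exact Or.inl (good₁_of_red_gate hC' hs (hred e' rfl) (fun f hf _ => hred f hf))

open Classical in
/-- **Case (iii), the weights**: with a non-switchable gate every admissible pattern has weight `≥ 1`. -/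
theorem one_le_weight_of_forced_gate {x : P.Term → Bool} (hx : P.Adm x) {C : Finset V} (hC : P.IsGate C)
    (hsw : P.sw C = false) : 1 ≤ P.weight x :=
  one_le_weight_of_good (good_of_forced_gate hx hC hsw)

end Forced


section Sums

variable [Fintype E] [DecidableEq E] [DecidableEq V] {P : Problem V E}

open Classical in
/-- **Case (iii) of THE LEMMA**: `0 ≤ Φ∨ P` when some gate is non-switchable. -/
theorem phiOr_nonneg_of_forced_gate {C : Finset V} (hC : P.IsGate C) (hsw : P.sw C = false) :
    0 ≤ P.phiOr := by
  unfold phiOr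
  apply Finset.sum_nonneg
  intro x _
  split_ifs with h
  · have := one_le_weight_of_forced_gate h.1 hC hsw
    omega
  · exact le_rfl

open Classical in
/-- **Case (iii) of THE LEMMA**: `0 ≤ Φ∧ P` when some gate is non-switchable. -/
theorem phiAnd_nonneg_of_forced_gate {C : Finset V} (hC : P.IsGate C) (hsw : P.sw C = false) :
    0 ≤ P.phiAnd := by
  unfold phiAnd
  apply Finset.sum_nonneg
  intro x _
  split_ifs with h
  · have := one_le_weight_of_forced_gate h.1 hC hsw
    omega
  · exact le_rfl

end Sums

end Problem

end ZonePort

end PercRepro
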